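import Mathlib.Data.ZMod.Basic
import Mathlib.Data.Int.GCD
import Mathlib.Data.Int.Interval
import Mathlib.Tactic.Ring
import Mathlib.Tactic.Linarith
import Mathlib.Tactic.NormNum
import Mathlib.Tactic.LinearCombination
import Mathlib.Tactic.IntervalCases
import HarnessLib

/-!
# Venture HSemireg — THEOREM LINE-DIOPHANTINE for O-TYPE seeds, arithmetic side (ENGINE-W PROBE5 §15): primitive values of the
# maximal-order norm form `x² + xy + ((1−m)∕4)·y²` — the R1 PROPER row (`c = 2`: never for `m ≡ 5 (mod 8)`, never for `m = −15, −23, −31`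
# (definite) and `m = 33` (mod 3), reached for `m = 17, 41, −7`), three O-type line tables of CONSEQUENCE (a) (`ℚ(√−7)`, `ℚ(√−15)`,
# `ℚ(√−11)`, `2 ≤ c ≤ 48`) with the completeness of the search box, and LEMMA 𝔞′_c's index remark — kernel arithmetic

HONEST FRAMING. Lean index of the computation cell `pub-hsemireg`, widening group ENGINE-W (code A, seat `engine-w-1`, gen 18).
ELEMENTARY ARITHMETIC AND BOUNDED SEARCHES ONLY; no order, ideal class, abelian variety, sheaf, `Ext` group, autoequivalence or
semiregularity map is constructed; nothing here says that HC, HC_CM or HC_AV holds. Theorems only (0 `def`, 0 named fact, 0 `sorry`).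
New namespace `OTypeLines`. Companions: `LineDiophantineArithmetic.lean` (the general-seed transport formula `transport_numerator`, the
`ℤ[√m]`-seed tables for `ℚ(i), ℚ(√−2), ℚ(√−7)`), `LineDiophantineCommonTwist.lean` (eight more `ℤ[√m]`-seed tables), `R1DiophantinePellTwo.lean`.

SOURCE (the cell's own result, by value): `widen/ENGINE-W/out/probe5/PROBE5-STIZ-A.md` §15 THEOREM LINE-DIOPHANTINE (O-type seeds):
«(iii) c = x² + xy + ((1−m)∕4)·y² with gcd(x,y) = 1»; CONSEQUENCES «(a) … TABLE (orep.A.json 18a47d7a03b614da; c ≤ 48): ℚ(√−7): O-type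
{2,4,7,8,11,14,16,22,23,28,29,32,37,43,44,46} …; ℚ(√−15): {4,6,10,15,16,19,24,31,34,40,46} …; ℚ(√−11): {3,5,9,11,15,23,25,27,31,33,37,45,47}»;
«(b) R1 PROPER for O-type seeds (c = 2): reached iff 2 = x² + xy + ((1−m)∕4)y² primitively — possible for m ≡ 1 (mod 8) only (2 splits in
O_{k′}) …: ℚ(√−7) YES (θ̄), ℚ(√17) YES (NEW: z = 2 + θ₁₇), ℚ(√41) yes (3 + θ), ℚ(√−15), ℚ(√−23), ℚ(√−31), ℚ(√33) NO; every m ≡ 5 (mod 8)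
NO»; LEMMA 𝔞′_c: «R′∕(c, θ_A) ≅ O_K∕(c, N(θ_A)) = O_K∕(c) since c ∣ Nt∕4 = N(θ_A) when N∕c and t are even». What the kernel holds
(write `k := (1−m)∕4`, so `m ≡ 5 (mod 8) ⟺ k odd`, `m ≡ 1 (mod 8) ⟺ k even`):

* §1 **`even_of_odd_k`**: `k` odd and `x² + xy + k·y² = 2·e` even ⟹ `x, y` both even (mod 2 the form is anisotropic) — so for
  `m ≡ 5 (mod 8)` NO even weight, in particular not `c = 2`, is primitively represented (`no_primitive_even_value_of_odd_k`).
* §2 **the R1 row** (`c = 2`): `R1_witnesses` (`m = 17: (2,1)`, `m = 41: (3,1)`, `m = −7: (0,1)`, all with `gcd = 1`), `ne_two_of_three_le`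
  (`k ≥ 3 ⟹ x² + xy + k·y² ≠ 2`, covering `m = −11, −15, −19, −23, −31, …`), `ne_two_sqrt33` (`k = −8`: `x² + xy − 8y² ≠ 2`, read mod 3).
* §3 **CONSEQUENCE (a)'s O-type tables** by `decide` over the complete box `x ∈ [−9,9]`, `y ∈ [−5,5]` (integers, `Int.gcd x y = 1`):
  `otable_neg7` (`k = 2`), `otable_neg15` (`k = 4`), `otable_neg11` (`k = 3`), each «`c ∈ [2,48]` lies in the printed set iff it is primitively
  represented»; `four_mul_form` (`4(x² + xy + ky²) = (2x+y)² + (4k−1)y²`) and `box_complete` (`k ≥ 2`, value `≤ 48` ⟹ `|y| ≤ 5 ∧ |x| ≤ 9`).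
* §4 **LEMMA 𝔞′_c's index remark** `index_remark` (`N = c·(2a)`, `t = 2b` ⟹ `N·t = 4·(c·a·b)`, i.e. `c ∣ Nt∕4 = N(θ_A)`) and
  `norm_thetaA` (`4·N(θ_A) = 4·(((A+1)∕2)² − ((A+1)∕2) + k′)`-free form: `(A² − m) = (A − 1)(A + 1) + (1 − m)`, the parity bookkeeping behind
  «θ_A = θ + (A−1)∕2 ∈ O_{k′}» for odd `A`).
-/

namespace Summit.Ventures.HSemireg.OTypeLines

/-! ## §1 `m ≡ 5 (mod 8)`: the form is odd on primitive vectors -/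

/-- **Anisotropy mod 2**: for odd `k`, if `x² + xy + k·y²` is even then `x` and `y` are both even. [kernel, `decide` on `ZMod 2`] -/
theorem even_of_odd_k {k x y e : ℤ} (hk : k % 2 = 1) (h : x ^ 2 + x * y + k * y ^ 2 = 2 * e) : x % 2 = 0 ∧ y % 2 = 0 := by
  have key : ∀ a b : ZMod 2, a ^ 2 + a * b + 1 * b ^ 2 = 0 → a = 0 ∧ b = 0 := by decide
  have hk2 : (k : ZMod 2) = 1 := by
    have e : k = 2 * (k / 2) + 1 := by omega
    have z2 : (2 : ZMod 2) = 0 := by decide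
    rw [e]; push_cast; rw [z2, zero_mul, zero_add]
  have hc := congrArg (fun t : ℤ => (t : ZMod 2)) h
  push_cast at hc
  have z2 : (2 : ZMod 2) = 0 := by decide
  rw [hk2, z2, zero_mul] at hc
  obtain ⟨ha, hb⟩ := key _ _ hc
  exact ⟨(ZMod.intCast_zmod_eq_zero_iff_dvd x 2).1 ha |> Int.emod_eq_zero_of_dvd,
    (ZMod.intCast_zmod_eq_zero_iff_dvd y 2).1 hb |> Int.emod_eq_zero_of_dvd⟩

/-- Hence for **`m ≡ 5 (mod 8)`** (`k` odd) NO even weight `c = 2e` is PRIMITIVELY represented by the `O_{k′}`-norm form — in particular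
R1 PROPER (`c = 2`) is never reached by an O-type seed there («every m ≡ 5 (mod 8) NO»). [kernel] -/
theorem no_primitive_even_value_of_odd_k {k x y e : ℤ} (hk : k % 2 = 1) (h : x ^ 2 + x * y + k * y ^ 2 = 2 * e)
    (hprim : Int.gcd x y = 1) : False := by
  obtain ⟨hx, hy⟩ := even_of_odd_k hk h
  have h2 : (2 : ℤ) ∣ (Int.gcd x y : ℤ) :=
    Int.dvd_coe_gcd (Int.dvd_of_emod_eq_zero hx) (Int.dvd_of_emod_eq_zero hy)
  rw [hprim] at h2
  norm_num at h2

/-! ## §2 The R1 PROPER row (`c = 2`) -/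

/-- **R1 witnesses** (`m ≡ 1 (mod 8)` fields where a prime above `2` is principal with a norm-`+2` generator): `ℚ(√17)` (`k = −4`):
`z = 2 + θ`, `4 + 2 − 4 = 2`; `ℚ(√41)` (`k = −10`): `3 + θ`, `9 + 3 − 10 = 2`; `ℚ(√−7)` (`k = 2`): `θ̄ ∼ (0,1)`, `0 + 0 + 2 = 2`; all primitive.
[kernel, `decide`∕`norm_num`] -/
theorem R1_witnesses :
    ((2 : ℤ) ^ 2 + 2 * 1 + (-4) * 1 ^ 2 = 2 ∧ Int.gcd 2 1 = 1) ∧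
    ((3 : ℤ) ^ 2 + 3 * 1 + (-10) * 1 ^ 2 = 2 ∧ Int.gcd 3 1 = 1) ∧
    ((0 : ℤ) ^ 2 + 0 * 1 + 2 * 1 ^ 2 = 2 ∧ Int.gcd 0 1 = 1) := by
  refine ⟨⟨by norm_num, by decide⟩, ⟨by norm_num, by decide⟩, ⟨by norm_num, by decide⟩⟩

/-- `4·(x² + xy + k·y²) = (2x + y)² + (4k − 1)·y²`. [kernel, `ring`] -/
theorem four_mul_form (k x y : ℤ) : 4 * (x ^ 2 + x * y + k * y ^ 2) = (2 * x + y) ^ 2 + (4 * k - 1) * y ^ 2 := by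
  ring

/-- **Definite fields with `k ≥ 3`** (`m = −11, −15, −19, −23, −31, …`): `x² + xy + k·y² ≠ 2` (if `y = 0` then `x² = 2`; else
`8 = (2x+y)² + (4k−1)y² ≥ 11`). So `ℚ(√−15)`, `ℚ(√−23)`, `ℚ(√−31)` have NO O-type class on R1 PROPER. [kernel] -/
theorem ne_two_of_three_le {k : ℤ} (hk : 3 ≤ k) (x y : ℤ) : x ^ 2 + x * y + k * y ^ 2 ≠ 2 := by
  intro h
  have h4 := four_mul_form k x y
  rw [h] at h4
  by_cases hy : y = 0
  · subst hy
    have hx : x ^ 2 = 2 := by nlinarith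
    have hxb : x ≤ 1 ∧ -1 ≤ x := by constructor <;> nlinarith
    obtain ⟨h1, h2⟩ := hxb
    interval_cases x <;> norm_num at hx
  · have hy2 : 1 ≤ y ^ 2 := by
      have : y ^ 2 ≠ 0 := pow_ne_zero 2 hy
      have : 0 ≤ y ^ 2 := sq_nonneg y
      omega
    nlinarith [sq_nonneg (2 * x + y)]

/-- **`ℚ(√33)`** (`k = −8`): `x² + xy − 8y² ≠ 2` — mod 3 the form is `x² + xy + y²`, whose residues are `0, 1`. [kernel, `decide` on `ZMod 3`] -/
theorem ne_two_sqrt33 (x y : ℤ) : x ^ 2 + x * y + (-8) * y ^ 2 ≠ 2 := by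
  intro h
  have key : ∀ a b : ZMod 3, a ^ 2 + a * b + (-8) * b ^ 2 ≠ 2 := by decide
  have hc := congrArg (fun t : ℤ => (t : ZMod 3)) h
  push_cast at hc
  exact key _ _ hc

/-! ## §3 CONSEQUENCE (a): three O-type line tables (`2 ≤ c ≤ 48`) -/

/-- **Completeness of the box**: for `k ≥ 2` a value `x² + xy + k·y² ≤ 48` forces `|y| ≤ 5` and `|x| ≤ 9`
(`(2x+y)² + (4k−1)y² ≤ 192`, `4k − 1 ≥ 7`). [kernel] -/
theorem box_complete {k : ℤ} (hk : 2 ≤ k) (x y : ℤ) (h : x ^ 2 + x * y + k * y ^ 2 ≤ 48) :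
    (-5 ≤ y ∧ y ≤ 5) ∧ (-9 ≤ x ∧ x ≤ 9) := by
  have h4 := four_mul_form k x y
  have hs : (2 * x + y) ^ 2 + (4 * k - 1) * y ^ 2 ≤ 192 := by linarith
  have hy2 : 7 * y ^ 2 ≤ 192 := by nlinarith [sq_nonneg (2 * x + y), sq_nonneg y]
  have hy : -5 ≤ y ∧ y ≤ 5 := by constructor <;> nlinarith
  have hu2 : (2 * x + y) ^ 2 ≤ 192 := by nlinarith [sq_nonneg y]
  have hu : -13 ≤ 2 * x + y ∧ 2 * x + y ≤ 13 := by constructor <;> nlinarith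
  refine ⟨hy, ?_, ?_⟩ <;> omega

/-- **O-type line table for `ℚ(√−7)`** (`k = 2`; card: {2,4,7,8,11,14,16,22,23,28,29,32,37,43,44,46}): `c ∈ [2,48]` is primitively
represented by `x² + xy + 2y²` exactly for the listed `c`. [kernel, `decide` over the complete box] -/
theorem otable_neg7 :
    ∀ c ∈ Finset.Icc (2 : ℤ) 48,
      (c ∈ ({2, 4, 7, 8, 11, 14, 16, 22, 23, 28, 29, 32, 37, 43, 44, 46} : Finset ℤ) ↔
        ∃ x ∈ Finset.Icc (-9 : ℤ) 9, ∃ y ∈ Finset.Icc (-5 : ℤ) 5, x ^ 2 + x * y + 2 * y ^ 2 = c ∧ Int.gcd x y = 1) := by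
  decide

/-- **O-type line table for `ℚ(√−15)`** (`k = 4`; card: {4,6,10,15,16,19,24,31,34,40,46}). [kernel, `decide`] -/
theorem otable_neg15 :
    ∀ c ∈ Finset.Icc (2 : ℤ) 48,
      (c ∈ ({4, 6, 10, 15, 16, 19, 24, 31, 34, 40, 46} : Finset ℤ) ↔
        ∃ x ∈ Finset.Icc (-9 : ℤ) 9, ∃ y ∈ Finset.Icc (-5 : ℤ) 5, x ^ 2 + x * y + 4 * y ^ 2 = c ∧ Int.gcd x y = 1) := by
  decide

/-- **O-type line table for `ℚ(√−11)`** (`k = 3`; card: {3,5,9,11,15,23,25,27,31,33,37,45,47}). [kernel, `decide`] -/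
theorem otable_neg11 :
    ∀ c ∈ Finset.Icc (2 : ℤ) 48,
      (c ∈ ({3, 5, 9, 11, 15, 23, 25, 27, 31, 33, 37, 45, 47} : Finset ℤ) ↔
        ∃ x ∈ Finset.Icc (-9 : ℤ) 9, ∃ y ∈ Finset.Icc (-5 : ℤ) 5, x ^ 2 + x * y + 3 * y ^ 2 = c ∧ Int.gcd x y = 1) := by
  decide

/-! ## §4 LEMMA 𝔞′_c's index remark -/

/-- **`c ∣ N·t∕4 = N(θ_A)` when `N∕c` and `t` are even**: `N = c·(2a)`, `t = 2b` ⟹ `N·t = 4·(c·a·b)`. [kernel, `ring`] -/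
theorem index_remark (c a b : ℤ) : (c * (2 * a)) * (2 * b) = 4 * (c * (a * b)) := by
  ring

/-- The norm of `θ_A = (A + √m)∕2` times `4` is `A² − m = N·t`; for odd `A = 2a + 1` and `m = 1 − 4k`:
`A² − m = 4·(a² + a + k)`, i.e. `N(θ_A) = a² + a + k` is the `O_{k′}`-norm form at `(a, 1)` — «θ_A = θ + (A−1)∕2». [kernel, `ring`] -/
theorem norm_thetaA (a k : ℤ) : (2 * a + 1) ^ 2 - (1 - 4 * k) = 4 * (a ^ 2 + a * 1 + k * 1 ^ 2) := by
  ring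

end Summit.Ventures.HSemireg.OTypeLines
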